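import Mathlib.LinearAlgebra.Dual.Lemmas
import Mathlib.LinearAlgebra.TensorProduct.Basic
import Literature.Algebra.Lie.LefschetzModuleHorizontalSubalgebra
import Literature.Algebra.Lie.LefschetzModuleInvariantFormIrreducible
import Literature.Algebra.Lie.LefschetzSl2TypeIsotypic
import Literature.Algebra.Lie.LefschetzAlgebraDualNumber
import HarnessLib

/-!
# Frobenius–Lefschetz modules and their invariant form (Looijenga–Lunts 1997, §6 (6.1), (6.3))

Topic `Literature/Algebra/Lie` (namespace `Literature.Algebra.Lie`).  Lane `lit-hodgefound` (Track 2 foundations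
library), skeleton seat `lit-hodgefound-skel-1` (generation 48), row **A1-156** of
`run/shared/lean/pub/lit-hodgefound/SKELETON.md`: the algebraic opening of Looijenga–Lunts' §6 "Frobenius–Lefschetz
modules" — the three notions of (6.1) (Frobenius, quasi-Frobenius, Frobenius up to order `d`) as DEFINITIONS WITH
BODIES (`structure … : Prop` over A1-88 `IsLefschetzModule`), and the (6.3) Proposition (a Frobenius–Lefschetz module
of depth `n` carries a non-degenerate `𝔤(𝔞, M)`-invariant `(-)^n`-symmetric bilinear form) PROVED along the printed
proof; plus a non-vacuity model (`H^•(ℙ¹)`, §6).  No named fact, no `sorry` (D-0026 net debt `0`).  Infrastructure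
reused, not restated: `IsLefschetzModule` / `degreeSpace` / `depth` / `lefschetzLieAlgebra` (A1-88), `primSubmodule` and
(1.13) (A1-102/103 `LefschetzModulePrimitive`), (1.3) "`f_a` kills every form that `h` and `e_a` kill" (A1-97
`LefschetzModuleInvariantForm`), "a non-zero invariant form on an irreducible Lefschetz module is non-degenerate" (A1-120
`LefschetzModuleInvariantFormIrreducible`), the parity of the degrees of an irreducible module (A1-118
`LefschetzSl2TypeIsotypic`), the component projectors `degreeComponent` (A1-149), and the model `K[ε]/(ε²)` (A1-121
`LefschetzAlgebraDualNumber`).  `LieRing.ofAssociativeRing` on `𝔤𝔩(M) = Module.End K M` is enabled FILE-LOCALLY as in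
the whole series, and so is A1-121's `gradedAlgebra` (a `def`) inside §6.

## Source, VERBATIM

E. Looijenga, V. A. Lunts, *A Lie algebra attached to a projective variety*, Invent. Math. **129** (1997) 361–412
(held TeX text `paper:arxiv-alg-geom_9604014`, p0023 L11–L26 and L49–L70; item numbers as in the held PDF text
`paper:arxiv-alg-geom-9604014` p0052 L1–L21):

> "(6.1) We say that a Lefschetz module `(M, 𝔞)` of depth `n` is Frobenius if it satisfies the following three
> properties: (1) `Prim M_{-n} = 1` is of dimension one (and so `M` is irreducible), (2) the map
> `𝔞 ⊗ M_{-n} → M_{-n+2}` is an isomorphism, (3) `M` is generated as a `U𝔞`-module by `M_{-n}`.  If only the first two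
> conditions are satisfied we say that `M` is a quasi-Frobenius of depth `n` and if instead of (3), we have (3′) the
> `U𝔞`-module generated by `M_{-n}` contains `M_{-n+2k}` for `k ≤ d`, then we say that `M` is Frobenius up to order
> `d`. […]
> The following proposition explains our terminology for it shows that a Lefschetz module `(M, 𝔞)` is Frobenius if
> and only if `M` is Frobenius (= Gorenstein) as a `U𝔞`-module.
> (6.3) Proposition. Let `(𝔞, M)` be a Frobenius–Lefschetz module of depth `n`. Then there exists a nondegenerate
> `𝔤(𝔞, M)`-invariant `(-)^n`-symmetric bilinear form on `M`.
> Proof. Since `dim M_{-n} = 1`, we also have `dim M_n = 1`. The choice of a generator `u ∈ M_{-n}` identifies `M`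
> with a graded quotient `R` of the symmetric algebra `U𝔞` (with a shift of degree). Pick a nonzero linear form
> `∫ : R_{2n} → ℂ`, and define a graded bilinear form `⟨ , ⟩ : M × M → ℂ` by `⟨au, bu⟩ = (-1)^k ∫(abu)` if `a ∈ R^{2k}`
> `b ∈ R^{2n-2k}`. This form is symmetric or skew according to whether `n` is even or odd. We claim that it is
> `𝔤(𝔞, M)`-invariant. For if we regard `⟨ , ⟩` as an element of the Lefschetz module `(M ⊗ M)^*`, then it is of
> degree zero and annihilated by `𝔞`. So if `f_a` (`a ∈ 𝔞`) is defined, then `⟨ , ⟩` is primitive for the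
> `𝔰𝔩₂`-triple `(e_a, h, f_a)` and hence annihilated by `f_a`. This proves our claim. Since `M` is irreducible,
> `⟨ , ⟩` must be nondegenerate."

ON THE WORDING OF (1).  Both the TeX and the PDF print "`Prim M_{-n} = 1` is of dimension one (and so `M` is
irreducible)".  Since `dim M_{-n} = 1` alone does not make a Lefschetz module irreducible, while by (1.13) (A1-103
`IsLefschetzModule.isIrreducible_iff`) "`Prim(M) = M_{-n}` is a line" does, (1) is rendered as the two clauses
`Prim(M) = M_{-n}` and `dim M_{-n} = 1`.  For FROBENIUS modules this choice is immaterial: `dim M_{-n} = 1` together with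
(3) already forces irreducibility and `Prim(M) = M_{-n}` (`IsLefschetzModule.isIrreducible_of_envelopingSpan_eq_top`,
`IsLefschetzModule.primSubmodule_eq_of_envelopingSpan_eq_top`, and the constructor `IsFrobeniusLefschetz.mk'`); only
for quasi-Frobenius modules does the first clause carry content.

## Rendering (dictionary)

* "a Lefschetz module `(M, 𝔞)` of depth `n`": `IsLefschetzModule K h 𝔞` (A1-88), `n = depth h`, `M_k = degreeSpace h k`.
* "`U𝔞`" (the image of the enveloping = symmetric algebra of the abelian `𝔞` in `𝔤𝔩(M)`): the subalgebra
  `Algebra.adjoin K (𝔞 : Set (𝔤𝔩(M)))`, written inline as in the series' Kleiman-algebra files; it is commutative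
  (`commute_of_mem_adjoin_of_mem_adjoin`) and `ad h`-stable (`IsLefschetzModule.lie_h_mem_adjoin`).
* "the `U𝔞`-module generated by" a subspace `S`: **`envelopingSpan 𝔞 S`** (§1) — the span of the `a v`, `a ∈ U𝔞`,
  `v ∈ S`; the least `𝔞`-stable subspace containing `S` (`envelopingSpan_le`); for a line, `U𝔞 (K u) = {a u}`
  (`mem_envelopingSpan_span_singleton_iff`).
* "(1) … `Prim M` … `M_{-n}` … of dimension one": `primSubmodule h 𝔞 = degreeSpace h (-n)` (A1-102) and
  `finrank K (degreeSpace h (-n)) = 1` — see ON THE WORDING OF (1).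
* "(2) the map `𝔞 ⊗ M_{-n} → M_{-n+2}` is an isomorphism": **`actionMap K 𝔞 S`** `: 𝔞 ⊗[K] S →ₗ M`, `a ⊗ v ↦ a v`
  (Mathlib `TensorProduct.lift`), is injective with range `M_{-n+2}` (its range lies there anyway, `range_actionMap_le`).
* "(3) `M` is generated as a `U𝔞`-module by `M_{-n}`": `envelopingSpan 𝔞 (degreeSpace h (-n)) = ⊤`;
  "(3′) … contains `M_{-n+2k}` for `k ≤ d`": `degreeSpace h (-n + 2k) ≤ envelopingSpan 𝔞 (degreeSpace h (-n))`.
* The three notions: **`IsQuasiFrobeniusLefschetz K h 𝔞`** ((1)+(2)), **`IsFrobeniusLefschetz K h 𝔞`** (+(3)),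
  **`IsFrobeniusLefschetzUpTo K h 𝔞 d`** (+(3′)), as `Prop`-valued structures extending one another.
* (6.3): "identifies `M` with … `R`": the evaluation `a ↦ a u` is a linear ISOMORPHISM `U𝔞 ≅ M` (**`evalGenEquiv`**;
  in `𝔤𝔩(M)` the "graded quotient `R`" of `U𝔞` is `U𝔞` itself, `injective_evalGen`), graded "with a shift of degree"
  (`lie_eq_smul_of_apply_mem`: `ev⁻¹(M_j) ⊆ 𝔤𝔩(M)_{j+n}(ad h)`); "`∫`": a linear form on `M` vanishing on the `M_j`,
  `j ≠ n` (`exists_dual_eq_zero_off_degree`); "`(-1)^k` if `a ∈ R^{2k}`": the diagonal operator **`signOp h n`**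
  (`(-1)^k` on `M_{-n+2k}`); the form **`frobeniusForm E σ ∫`**`(m, m') = ∫((ev⁻¹(σ m)) m')`, so that
  `⟨au, bu⟩ = (-1)^k ∫(abu)` (`frobeniusForm_apply_apply_gen`); "`𝔤(𝔞, M)`-invariant": `φ.IsSkewAdjoint x` for all
  `x ∈ lefschetzLieAlgebra K h 𝔞`; "graded" / "of degree zero": `φ(M_j, M_{j'}) = 0` unless `j + j' = 0`;
  "`(-)^n`-symmetric": `φ m' m = (-1)^n φ m m'`; "nondegenerate": Mathlib `LinearMap.BilinForm.Nondegenerate`.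

## Contents (all proved)

* §0 `U𝔞`: `commute_of_mem_adjoin_of_mem_adjoin`, `lie_mem_adjoin_of_forall_lie_mem` (`ad x` is a derivation),
  `apply_mem_of_mem_adjoin`.  §1 `envelopingSpan` and its API (`le_envelopingSpan`, `apply_mem_envelopingSpan`,
  `envelopingSpan_le`, `envelopingSpan_mono`, `envelopingSpan_span_singleton`, `mem_envelopingSpan_span_singleton_iff`).
* §2 (6.1): `actionMap` (`actionMap_tmul`, `range_actionMap_le`), **`IsQuasiFrobeniusLefschetz`**,
  **`IsFrobeniusLefschetz`**, **`IsFrobeniusLefschetzUpTo`**, `IsFrobeniusLefschetz.isFrobeniusLefschetzUpTo`.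
* §3 the evaluation isomorphism: `evalGen`, `surjective_evalGen`, `injective_evalGen`, **`evalGenEquiv`** and its
  calculus (`evalGenEquiv_symm_apply_gen`, `…_symm_apply_of_mem`, `…_symm_gen`, `…_symm_apply_apply`),
  **`lie_eq_smul_of_apply_mem`** / `evalGenEquiv_symm_mem_adDegree` (gradedness).
* §4 structure of Frobenius modules: `exists_eq_span_singleton_of_finrank_eq_one`,
  **`IsLefschetzModule.finrank_degreeSpace_depth`** ("`dim M_n = dim M_{-n}`"),
  **`IsLefschetzModule.isIrreducible_of_primSubmodule_eq`** ("and so `M` is irreducible"),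
  **`IsLefschetzModule.isIrreducible_of_envelopingSpan_eq_top`** and `…primSubmodule_eq_of_envelopingSpan_eq_top`
  (see ON THE WORDING OF (1)), `IsFrobeniusLefschetz.mk'`, `IsQuasiFrobeniusLefschetz.nontrivial` / `.isIrreducible`,
  `IsLefschetzModule.exists_eq_neg_depth_add_of_ne_bot` (the non-zero degrees are `-n, -n+2, …, n`).
* §5 (6.3): `signOp` (`signOp_apply_of_mem`, `signOp_apply_of_mem'`), `frobeniusForm` (`frobeniusForm_apply`,
  **`frobeniusForm_apply_apply_gen`** = "`⟨au, bu⟩ = (-1)^k ∫(abu)`"), **`isSkewAdjoint_frobeniusForm_of_mem`**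
  ("annihilated by `𝔞`"), **`frobeniusForm_apply_eq_zero_of_ne`** ("of degree zero"), `isSkewAdjoint_frobeniusForm_h`,
  **`isSkewAdjoint_frobeniusForm_of_mem_lefschetzLieAlgebra`** ("hence annihilated by `f_a`", via A1-97),
  `frobeniusForm_gen_apply` (`φ ≠ 0`), **`frobeniusForm_comm`** ("symmetric or skew according to … `n`"),
  `exists_dual_eq_zero_off_degree` ("pick a nonzero linear form `∫`"), and the Proposition
  **`IsFrobeniusLefschetz.exists_bilinForm`**.
* §6 model: **`LefschetzDualNumber.isFrobeniusLefschetz`** — `H^•(ℙ¹; K)[1] = (K[ε]/(ε²))[1]` over `A_2 = K ε` is a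
  Frobenius–Lefschetz module of depth `1` (with `finrank_degreeSpace_neg_one`, `injective_actionMap`,
  `range_actionMap_eq`, `envelopingSpan_eq_top`), and `exists_bilinForm_skew` (its (6.3) form is skew).

## SCOPE (not formalised here)

(a) (6.2) (the quasi-Frobenius submodule of `H(X)` generated by `H^0(X)` for a Kähler / projective manifold) —
geometric.  (b) The remarks p0023 L28–L32: "if `A` is Lefschetz algebra of depth `n`, then `A[n]` is a
Frobenius–Lefschetz module of `A_2` if and only if `A` is generated by `A_2`. Moreover, any Frobenius–Lefschetz module is
of this form" and "a Jordan–Lefschetz module is Frobenius" — only the instance `A = K[ε]/(ε²)` is done (§6).  (c) "`M` is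
Frobenius (= Gorenstein) as a `U𝔞`-module" is not introduced as a notion.  (d) (6.4)–(6.16) (the example
`V(2k) ⊕ V(2k-2)`, the root-system analysis of quasi-Frobenius modules, Theorem (6.8)).  (e) Nothing here concerns
complex tori or the Hodge conjecture.

## References

* [LooijengaLunts1997] E. Looijenga, V. A. Lunts, *A Lie algebra attached to a projective variety*, Invent. Math. 129
  (1997) 361–412; arXiv:alg-geom/9604014. §6 (6.1) p. 23 L11–L32, (6.3) Proposition and proof p. 23 L49–L70 of the
  held TeX text (`paper:arxiv-alg-geom_9604014`; = p0052 of the held PDF text `paper:arxiv-alg-geom-9604014`); §1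
  (1.3) p. 5, (1.13) p. 7.
* [Bourbaki1989LieGroups13] N. Bourbaki, *Lie Groups and Lie Algebras, Chapters 1–3*, Ch. I §6 no. 2 Thm. 2 (Weyl's
  complete reducibility) — via the tree's `exists_isCompl_lieSubmodule_of_isSemisimple`.
-/

noncomputable section

namespace Literature.Algebra.Lie

open Module Function Set LieModule
open LinearMap (BilinForm)
open scoped TensorProduct

-- The commutator Lie ring of `𝔤𝔩(M) = Module.End K M`: Mathlib's reducible NON-instance
-- `LieRing.ofAssociativeRing`, enabled file-locally exactly as in `LefschetzModule.lean`.
attribute [local instance 100] LieRing.ofAssociativeRing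

/-! ### §0 The commutative subalgebra `U𝔞 ⊂ 𝔤𝔩(M)` generated by `𝔞` -/

section Enveloping

variable {K : Type*} [Field K] {M : Type*} [AddCommGroup M] [Module K M]
  {𝔞 : Submodule K (Module.End K M)}

/-- `U𝔞` — the subalgebra `Algebra.adjoin K 𝔞` of `𝔤𝔩(M)` generated by the commuting operators `e_a`, `a ∈ 𝔞` (the
image in `𝔤𝔩(M)` of the universal enveloping = symmetric algebra of the abelian Lie algebra `𝔞`) — is COMMUTATIVE.
[cite: LooijengaLunts1997, §6 (6.1) p. 23 L20 ("generated as a U𝔞-module"), (6.3) proof p. 23 L58 ("the symmetric algebra U𝔞")] -/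
theorem commute_of_mem_adjoin_of_mem_adjoin (h𝔞 : ∀ a ∈ 𝔞, ∀ b ∈ 𝔞, Commute a b) {x y : Module.End K M}
    (hx : x ∈ Algebra.adjoin K (𝔞 : Set (Module.End K M)))
    (hy : y ∈ Algebra.adjoin K (𝔞 : Set (Module.End K M))) : Commute x y :=
  Algebra.commute_of_mem_adjoin_of_forall_mem_commute hy fun b hb ↦
    (Algebra.commute_of_mem_adjoin_of_forall_mem_commute hx fun a ha ↦ h𝔞 b hb a ha).symm

/-- `ad x` is a derivation of `𝔤𝔩(M)`: a subalgebra `Algebra.adjoin K s` whose generators are sent into it by `ad x`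
is `ad x`-stable. [cite: LooijengaLunts1997, §6 (6.3) proof p. 23 L57–L58 ("a graded quotient R of the symmetric algebra U𝔞")] -/
theorem lie_mem_adjoin_of_forall_lie_mem {s : Set (Module.End K M)} (x : Module.End K M)
    (hs : ∀ a ∈ s, ⁅x, a⁆ ∈ Algebra.adjoin K s) {y : Module.End K M} (hy : y ∈ Algebra.adjoin K s) :
    ⁅x, y⁆ ∈ Algebra.adjoin K s := by
  refine Algebra.adjoin_induction (p := fun y _ ↦ ⁅x, y⁆ ∈ Algebra.adjoin K s) hs ?_ ?_ ?_ hy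
  · intro r
    rw [Algebra.algebraMap_eq_smul_one, lie_smul, Ring.lie_def, mul_one, one_mul, sub_self, smul_zero]
    exact Subalgebra.zero_mem _
  · intro y z _ _ hy hz
    rw [lie_add]
    exact Subalgebra.add_mem _ hy hz
  · intro y z hy' hz' hy hz
    have h1 : ⁅x, y * z⁆ = ⁅x, y⁆ * z + y * ⁅x, z⁆ := by
      simp only [Ring.lie_def, mul_sub, sub_mul, mul_assoc]
      abel
    rw [h1]
    exact Subalgebra.add_mem _ (Subalgebra.mul_mem _ hy hz') (Subalgebra.mul_mem _ hy' hz)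

/-- A subspace `N ⊆ M` stable under the generators `s` is stable under `Algebra.adjoin K s` ("`U𝔞`-module").
[cite: LooijengaLunts1997, §6 (6.1) p. 23 L20, L24 ("the U𝔞-module generated by M_{-n}")] -/
theorem apply_mem_of_mem_adjoin {s : Set (Module.End K M)} {N : Submodule K M} (hN : ∀ a ∈ s, ∀ m ∈ N, a m ∈ N)
    {x : Module.End K M} (hx : x ∈ Algebra.adjoin K s) {m : M} (hm : m ∈ N) : x m ∈ N := by
  suffices hh : ∀ m ∈ N, x m ∈ N from hh m hm
  refine Algebra.adjoin_induction (p := fun x _ ↦ ∀ m ∈ N, x m ∈ N) hN ?_ ?_ ?_ hx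
  · intro r m hm
    rw [Algebra.algebraMap_eq_smul_one, LinearMap.smul_apply, Module.End.one_apply]
    exact N.smul_mem r hm
  · intro x y _ _ hx hy m hm
    rw [LinearMap.add_apply]
    exact N.add_mem (hx m hm) (hy m hm)
  · intro x y _ _ hx hy m hm
    rw [Module.End.mul_apply]
    exact hx _ (hy m hm)

/-! ### §1 "The `U𝔞`-module generated by" a subspace -/

/-- **The `U𝔞`-submodule of `M` generated by a subspace `S`**: the `K`-span of the vectors `a v`, `a ∈ U𝔞 =
Algebra.adjoin K 𝔞`, `v ∈ S` — the least `𝔞`-stable subspace of `M` containing `S` (`le_envelopingSpan`,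
`apply_mem_envelopingSpan`, `envelopingSpan_le`). [cite: LooijengaLunts1997, §6 (6.1) p. 23 L20 ("M is generated as a U𝔞-module by M_{-n}"), L24 ("the U𝔞-module generated by M_{-n}")] -/
def envelopingSpan (𝔞 : Submodule K (Module.End K M)) (S : Submodule K M) : Submodule K M :=
  Submodule.span K {m : M | ∃ a ∈ Algebra.adjoin K (𝔞 : Set (Module.End K M)), ∃ v ∈ S, a v = m}

variable {S : Submodule K M}

/-- The generators `a v` lie in the generated module. [cite: LooijengaLunts1997, §6 (6.1) p. 23 L20] -/
theorem apply_mem_envelopingSpan_of_mem {a : Module.End K M} (ha : a ∈ Algebra.adjoin K (𝔞 : Set (Module.End K M)))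
    {v : M} (hv : v ∈ S) : a v ∈ envelopingSpan 𝔞 S :=
  Submodule.subset_span ⟨a, ha, v, hv, rfl⟩

/-- `S ⊆ U𝔞 · S`. [cite: LooijengaLunts1997, §6 (6.1) p. 23 L20] -/
theorem le_envelopingSpan : S ≤ envelopingSpan 𝔞 S := fun v hv ↦ by
  have h1 := apply_mem_envelopingSpan_of_mem (Subalgebra.one_mem (Algebra.adjoin K (𝔞 : Set (Module.End K M)))) hv
  rwa [Module.End.one_apply] at h1

/-- `U𝔞 · S` is stable under `U𝔞` (it is a `U𝔞`-module). [cite: LooijengaLunts1997, §6 (6.1) p. 23 L20] -/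
theorem apply_mem_envelopingSpan {a : Module.End K M} (ha : a ∈ Algebra.adjoin K (𝔞 : Set (Module.End K M))) {m : M}
    (hm : m ∈ envelopingSpan 𝔞 S) : a m ∈ envelopingSpan 𝔞 S := by
  induction hm using Submodule.span_induction with
  | mem m hm =>
    obtain ⟨b, hb, v, hv, rfl⟩ := hm
    rw [← Module.End.mul_apply]
    exact apply_mem_envelopingSpan_of_mem (Subalgebra.mul_mem _ ha hb) hv
  | zero => rw [map_zero]; exact Submodule.zero_mem _
  | add m m' _ _ hm hm' => rw [map_add]; exact Submodule.add_mem _ hm hm'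
  | smul c m _ hm => rw [map_smul]; exact Submodule.smul_mem _ c hm

/-- **Minimality**: an `𝔞`-stable subspace containing `S` contains the `U𝔞`-module generated by `S`.
[cite: LooijengaLunts1997, §6 (6.1) p. 23 L20, L24] -/
theorem envelopingSpan_le {N : Submodule K M} (hSN : S ≤ N) (hN : ∀ a ∈ 𝔞, ∀ m ∈ N, a m ∈ N) :
    envelopingSpan 𝔞 S ≤ N := by
  refine Submodule.span_le.2 ?_
  rintro _ ⟨a, ha, v, hv, rfl⟩
  exact apply_mem_of_mem_adjoin hN ha (hSN hv)

/-- Monotonicity in `S`. [cite: LooijengaLunts1997, §6 (6.1) p. 23 L24] -/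
theorem envelopingSpan_mono {S T : Submodule K M} (hST : S ≤ T) : envelopingSpan 𝔞 S ≤ envelopingSpan 𝔞 T :=
  Submodule.span_mono fun _ ⟨a, ha, v, hv, hm⟩ ↦ ⟨a, ha, v, hST hv, hm⟩

/-- For a LINE `S = K u` the generated module is `U𝔞 u = {a u | a ∈ U𝔞}` — the image of `U𝔞` under evaluation at
`u` ("The choice of a generator `u ∈ M_{-n}` identifies `M` with a graded quotient `R` of … `U𝔞`").
[cite: LooijengaLunts1997, §6 (6.3) proof p. 23 L57–L58] -/
theorem envelopingSpan_span_singleton (u : M) :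
    envelopingSpan 𝔞 (K ∙ u) =
      (Subalgebra.toSubmodule (Algebra.adjoin K (𝔞 : Set (Module.End K M)))).map (LinearMap.applyₗ u) := by
  refine le_antisymm (Submodule.span_le.2 ?_) ?_
  · rintro _ ⟨a, ha, v, hv, rfl⟩
    obtain ⟨c, rfl⟩ := Submodule.mem_span_singleton.1 hv
    refine ⟨c • a, ?_, ?_⟩
    · rw [SetLike.mem_coe, Subalgebra.mem_toSubmodule]
      exact Subalgebra.smul_mem _ ha c
    · rw [LinearMap.applyₗ_apply_apply, LinearMap.smul_apply, map_smul]
  · rintro _ ⟨a, ha, rfl⟩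
    rw [SetLike.mem_coe, Subalgebra.mem_toSubmodule] at ha
    rw [LinearMap.applyₗ_apply_apply]
    exact apply_mem_envelopingSpan_of_mem ha (Submodule.mem_span_singleton_self u)

/-- … elementwise: `m ∈ U𝔞 (K u) ↔ m = a u` for some `a ∈ U𝔞`. [cite: LooijengaLunts1997, §6 (6.3) proof p. 23 L57–L58] -/
theorem mem_envelopingSpan_span_singleton_iff {u m : M} :
    m ∈ envelopingSpan 𝔞 (K ∙ u) ↔ ∃ a ∈ Algebra.adjoin K (𝔞 : Set (Module.End K M)), a u = m := by
  rw [envelopingSpan_span_singleton, Submodule.mem_map]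
  constructor
  · rintro ⟨a, ha, rfl⟩
    exact ⟨a, (Subalgebra.mem_toSubmodule _).1 ha, (LinearMap.applyₗ_apply_apply u a)⟩
  · rintro ⟨a, ha, rfl⟩
    exact ⟨a, (Subalgebra.mem_toSubmodule _).2 ha, (LinearMap.applyₗ_apply_apply u a)⟩

end Enveloping

/-! ### §2 (6.1): Frobenius, quasi-Frobenius, Frobenius up to order `d` -/

section Definitions

variable (K : Type*) [Field K] {M : Type*} [AddCommGroup M] [Module K M]

/-- **"the map `𝔞 ⊗ M_{-n} → M_{-n+2}`"** (here into `M`; its image lies in `M_{-n+2}` since `𝔞` has degree `2`,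
`range_actionMap_le`): `a ⊗ v ↦ a v` on `𝔞 ⊗_K S` for a subspace `S ⊆ M`. [cite: LooijengaLunts1997, §6 (6.1) (2) p. 23 L17–L18] -/
def actionMap (𝔞 : Submodule K (Module.End K M)) (S : Submodule K M) : ↥𝔞 ⊗[K] ↥S →ₗ[K] M :=
  TensorProduct.lift ((LinearMap.applyₗ.comp S.subtype).flip.comp 𝔞.subtype)

variable {K}

/-- `actionMap (a ⊗ v) = a v`. [cite: LooijengaLunts1997, §6 (6.1) (2) p. 23 L17–L18] -/
@[simp] theorem actionMap_tmul (𝔞 : Submodule K (Module.End K M)) (S : Submodule K M) (a : 𝔞) (v : S) :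
    actionMap K 𝔞 S (a ⊗ₜ v) = (a : Module.End K M) (v : M) := by
  simp [actionMap]

variable (K) [CharZero K] [FiniteDimensional K M]

/-- **(6.1), QUASI-FROBENIUS: "If only the first two conditions are satisfied we say that `M` is a quasi-Frobenius
of depth `n`"** — a Lefschetz module `(𝔞, M)` (A1-88 `IsLefschetzModule`, `n = depth M`) with
(1) "`Prim M_{-n} = 1` [sic] is of dimension one (and so `M` is irreducible)", read — as the parenthesis requires, cf.
(1.13) — as: the primitive subspace `Prim(M)` (A1-102 `primSubmodule`) IS the lowest-degree line `M_{-n}`, of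
dimension one (for FROBENIUS modules the clause `Prim(M) = M_{-n}` is implied by the others,
`IsLefschetzModule.primSubmodule_eq_of_envelopingSpan_eq_top`); (2) "the map `𝔞 ⊗ M_{-n} → M_{-n+2}` is an
isomorphism": `actionMap` is injective with image `M_{-n+2}`. [cite: LooijengaLunts1997, §6 (6.1) p. 23 L11–L22] -/
structure IsQuasiFrobeniusLefschetz (h : Module.End K M) (𝔞 : Submodule K (Module.End K M)) : Prop where
  /-- "a Lefschetz module `(M, 𝔞)` of depth `n`" -/
  isLefschetzModule : IsLefschetzModule K h 𝔞
  /-- (1a) "`Prim M` [=] `M_{-n}`" -/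
  primSubmodule_eq : primSubmodule h 𝔞 = degreeSpace h (-(depth h : ℤ))
  /-- (1b) "… is of dimension one" -/
  finrank_eq_one : Module.finrank K (degreeSpace h (-(depth h : ℤ))) = 1
  /-- (2a) "the map `𝔞 ⊗ M_{-n} → M_{-n+2}` is an isomorphism": injective … -/
  injective_actionMap : Function.Injective (actionMap K 𝔞 (degreeSpace h (-(depth h : ℤ))))
  /-- (2b) … and onto `M_{-n+2}` -/
  range_actionMap : LinearMap.range (actionMap K 𝔞 (degreeSpace h (-(depth h : ℤ)))) = degreeSpace h (-(depth h : ℤ) + 2)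

/-- **(6.1), FROBENIUS: "We say that a Lefschetz module `(M, 𝔞)` of depth `n` is Frobenius if it satisfies the
following three properties: (1) […] (2) […] (3) `M` is generated as a `U𝔞`-module by `M_{-n}`."**
[cite: LooijengaLunts1997, §6 (6.1) p. 23 L11–L20] -/
structure IsFrobeniusLefschetz (h : Module.End K M) (𝔞 : Submodule K (Module.End K M)) : Prop
    extends IsQuasiFrobeniusLefschetz K h 𝔞 where
  /-- (3) "`M` is generated as a `U𝔞`-module by `M_{-n}`" -/
  envelopingSpan_eq_top : envelopingSpan 𝔞 (degreeSpace h (-(depth h : ℤ))) = ⊤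

/-- **(6.1), FROBENIUS UP TO ORDER `d`: "if instead of (3), we have (3′) the `U𝔞`-module generated by `M_{-n}`
contains `M_{-n+2k}` for `k ≤ d`, then we say that `M` is Frobenius up to order `d`."**
[cite: LooijengaLunts1997, §6 (6.1) p. 23 L22–L26] -/
structure IsFrobeniusLefschetzUpTo (h : Module.End K M) (𝔞 : Submodule K (Module.End K M)) (d : ℕ) : Prop
    extends IsQuasiFrobeniusLefschetz K h 𝔞 where
  /-- (3′) "the `U𝔞`-module generated by `M_{-n}` contains `M_{-n+2k}` for `k ≤ d`" -/
  degreeSpace_le_envelopingSpan : ∀ k : ℕ, k ≤ d →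
    degreeSpace h (-(depth h : ℤ) + 2 * k) ≤ envelopingSpan 𝔞 (degreeSpace h (-(depth h : ℤ)))

variable {K} {h : Module.End K M} {𝔞 : Submodule K (Module.End K M)}

omit [CharZero K] [FiniteDimensional K M] in
/-- The image of `𝔞 ⊗ M_k → M` lies in `M_{k+2}` when `𝔞` acts by operators of degree `2`.
[cite: LooijengaLunts1997, §6 (6.1) (2) p. 23 L17–L18] -/
theorem range_actionMap_le (h𝔞 : ∀ a ∈ 𝔞, ∀ k : ℤ, MapsTo a (degreeSpace h k) (degreeSpace h (k + 2))) (k : ℤ) :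
    LinearMap.range (actionMap K 𝔞 (degreeSpace h k)) ≤ degreeSpace h (k + 2) := by
  rintro _ ⟨t, rfl⟩
  induction t using TensorProduct.induction_on with
  | zero => rw [map_zero]; exact Submodule.zero_mem _
  | tmul a v => rw [actionMap_tmul]; exact h𝔞 a a.2 k v.2
  | add x y hx hy => rw [map_add]; exact Submodule.add_mem _ hx hy

omit [CharZero K] [FiniteDimensional K M] in
/-- A Frobenius–Lefschetz module is Frobenius up to every order. [cite: LooijengaLunts1997, §6 (6.1) p. 23 L20–L26] -/
theorem IsFrobeniusLefschetz.isFrobeniusLefschetzUpTo (F : IsFrobeniusLefschetz K h 𝔞) (d : ℕ) :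
    IsFrobeniusLefschetzUpTo K h 𝔞 d where
  toIsQuasiFrobeniusLefschetz := F.toIsQuasiFrobeniusLefschetz
  degreeSpace_le_envelopingSpan _ _ := by rw [F.envelopingSpan_eq_top]; exact le_top

end Definitions

/-! ### §3 "The choice of a generator `u ∈ M_{-n}` identifies `M` with … `U𝔞`": the evaluation isomorphism -/

section Evaluation

variable {K : Type*} [Field K] {M : Type*} [AddCommGroup M] [Module K M]
  {h : Module.End K M} {𝔞 : Submodule K (Module.End K M)}

/-- **Evaluation at `u`**: `U𝔞 → M`, `a ↦ a u` (on the underlying subspace of `U𝔞 = Algebra.adjoin K 𝔞`).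
[cite: LooijengaLunts1997, §6 (6.3) proof p. 23 L57–L58] -/
def evalGen (𝔞 : Submodule K (Module.End K M)) (u : M) :
    ↥(Subalgebra.toSubmodule (Algebra.adjoin K (𝔞 : Set (Module.End K M)))) →ₗ[K] M :=
  (LinearMap.applyₗ u).comp (Submodule.subtype _)

/-- `ev(a) = a u`. [cite: LooijengaLunts1997, §6 (6.3) proof p. 23 L57–L58] -/
@[simp] theorem evalGen_apply (u : M) (a : ↥(Subalgebra.toSubmodule (Algebra.adjoin K (𝔞 : Set (Module.End K M))))) :
    evalGen 𝔞 u a = (a : Module.End K M) u := rfl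

/-- Under (3) (`U𝔞 (K u) = M`) evaluation at `u` is SURJECTIVE. [cite: LooijengaLunts1997, §6 (6.3) proof p. 23 L57–L58] -/
theorem surjective_evalGen {u : M} (htop : envelopingSpan 𝔞 (K ∙ u) = ⊤) : Surjective (evalGen 𝔞 u) := by
  intro m
  have hm : m ∈ envelopingSpan 𝔞 (K ∙ u) := by rw [htop]; exact Submodule.mem_top
  obtain ⟨a, ha, rfl⟩ := mem_envelopingSpan_span_singleton_iff.1 hm
  exact ⟨⟨a, (Subalgebra.mem_toSubmodule _).2 ha⟩, rfl⟩

/-- … and INJECTIVE, `U𝔞` being commutative: `a u = 0` forces `a (b u) = b (a u) = 0` on all of `M = U𝔞 u` (so the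
"graded quotient `R`" of `U𝔞 ⊂ 𝔤𝔩(M)` is `U𝔞` itself). [cite: LooijengaLunts1997, §6 (6.3) proof p. 23 L57–L58] -/
theorem injective_evalGen (h𝔞 : ∀ a ∈ 𝔞, ∀ b ∈ 𝔞, Commute a b) {u : M} (htop : envelopingSpan 𝔞 (K ∙ u) = ⊤) :
    Injective (evalGen 𝔞 u) := by
  rw [← LinearMap.ker_eq_bot, Submodule.eq_bot_iff]
  rintro ⟨a, ha⟩ ha0
  rw [LinearMap.mem_ker, evalGen_apply] at ha0
  rw [Subalgebra.mem_toSubmodule] at ha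
  refine Subtype.ext (LinearMap.ext fun m ↦ ?_)
  obtain ⟨⟨b, hb⟩, rfl⟩ := surjective_evalGen htop m
  rw [Subalgebra.mem_toSubmodule] at hb
  change a (b u) = 0
  rw [← Module.End.mul_apply, (commute_of_mem_adjoin_of_mem_adjoin h𝔞 ha hb).eq, Module.End.mul_apply, ha0,
    map_zero]

/-- **"The choice of a generator `u ∈ M_{-n}` identifies `M` with [`R = U𝔞`]"**: the evaluation isomorphism
`U𝔞 ≃ M`, `a ↦ a u`, for `𝔞` commutative and `M = U𝔞 u`. [cite: LooijengaLunts1997, §6 (6.3) proof p. 23 L57–L58] -/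
def evalGenEquiv (h𝔞 : ∀ a ∈ 𝔞, ∀ b ∈ 𝔞, Commute a b) {u : M} (htop : envelopingSpan 𝔞 (K ∙ u) = ⊤) :
    ↥(Subalgebra.toSubmodule (Algebra.adjoin K (𝔞 : Set (Module.End K M)))) ≃ₗ[K] M :=
  LinearEquiv.ofBijective (evalGen 𝔞 u) ⟨injective_evalGen h𝔞 htop, surjective_evalGen htop⟩

variable (h𝔞 : ∀ a ∈ 𝔞, ∀ b ∈ 𝔞, Commute a b) {u : M} (htop : envelopingSpan 𝔞 (K ∙ u) = ⊤)

/-- `ev(a) = a u` for the isomorphism. [cite: LooijengaLunts1997, §6 (6.3) proof p. 23 L57–L58] -/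
@[simp] theorem evalGenEquiv_apply (a : ↥(Subalgebra.toSubmodule (Algebra.adjoin K (𝔞 : Set (Module.End K M))))) :
    evalGenEquiv h𝔞 htop a = (a : Module.End K M) u := rfl

/-- `(ev⁻¹ m) u = m`. [cite: LooijengaLunts1997, §6 (6.3) proof p. 23 L57–L58] -/
@[simp] theorem evalGenEquiv_symm_apply_gen (m : M) :
    ((evalGenEquiv h𝔞 htop).symm m : Module.End K M) u = m := by
  have h1 := (evalGenEquiv h𝔞 htop).apply_symm_apply m
  rwa [evalGenEquiv_apply] at h1

/-- `(ev⁻¹ m)` lies in `U𝔞`. [cite: LooijengaLunts1997, §6 (6.3) proof p. 23 L57–L58] -/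
theorem evalGenEquiv_symm_mem (m : M) :
    ((evalGenEquiv h𝔞 htop).symm m : Module.End K M) ∈ Algebra.adjoin K (𝔞 : Set (Module.End K M)) :=
  (Subalgebra.mem_toSubmodule _).1 ((evalGenEquiv h𝔞 htop).symm m).2

/-- `ev⁻¹ (a u) = a` for `a ∈ U𝔞`. [cite: LooijengaLunts1997, §6 (6.3) proof p. 23 L57–L58] -/
theorem evalGenEquiv_symm_apply_of_mem {a : Module.End K M} (ha : a ∈ Algebra.adjoin K (𝔞 : Set (Module.End K M))) :
    ((evalGenEquiv h𝔞 htop).symm (a u) : Module.End K M) = a := by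
  have h1 : (evalGenEquiv h𝔞 htop) ⟨a, (Subalgebra.mem_toSubmodule _).2 ha⟩ = a u := rfl
  rw [← h1, LinearEquiv.symm_apply_apply]

/-- `ev⁻¹ u = 1`. [cite: LooijengaLunts1997, §6 (6.3) proof p. 23 L57–L58] -/
theorem evalGenEquiv_symm_gen : ((evalGenEquiv h𝔞 htop).symm u : Module.End K M) = 1 := by
  have h1 := evalGenEquiv_symm_apply_of_mem h𝔞 htop (Subalgebra.one_mem (Algebra.adjoin K (𝔞 : Set (Module.End K M))))
  rwa [Module.End.one_apply] at h1

/-- `ev⁻¹ (a m) = a * ev⁻¹ m` for `a ∈ U𝔞` (`R`-linearity of the identification). [cite: LooijengaLunts1997, §6 (6.3) proof p. 23 L57–L62] -/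
theorem evalGenEquiv_symm_apply_apply {a : Module.End K M} (ha : a ∈ Algebra.adjoin K (𝔞 : Set (Module.End K M)))
    (m : M) : ((evalGenEquiv h𝔞 htop).symm (a m) : Module.End K M) = a * (evalGenEquiv h𝔞 htop).symm m := by
  conv_lhs => rw [← evalGenEquiv_symm_apply_gen h𝔞 htop m, ← Module.End.mul_apply]
  exact evalGenEquiv_symm_apply_of_mem h𝔞 htop (Subalgebra.mul_mem _ ha (evalGenEquiv_symm_mem h𝔞 htop m))

include h𝔞 htop in
/-- **The identification is graded ("with a shift of degree"): `R^{2k} u = M_{-n+2k}`** — if `u ∈ M_{-n}` and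
`a u ∈ M_j` (`a ∈ U𝔞`), then `[h, a] = (j + n) a`, provided `ad h` preserves `U𝔞`.
[cite: LooijengaLunts1997, §6 (6.3) proof p. 23 L57–L62] -/
theorem lie_eq_smul_of_apply_mem (hU : ∀ a ∈ Algebra.adjoin K (𝔞 : Set (Module.End K M)),
      ⁅h, a⁆ ∈ Algebra.adjoin K (𝔞 : Set (Module.End K M)))
    {n : ℤ} (hu : u ∈ degreeSpace h n) {a : Module.End K M}
    (ha : a ∈ Algebra.adjoin K (𝔞 : Set (Module.End K M))) {j : ℤ} (hj : a u ∈ degreeSpace h j) :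
    ⁅h, a⁆ = ((j - n : ℤ) : K) • a := by
  have hinj := injective_evalGen h𝔞 htop
  have h1 : evalGen 𝔞 u ⟨⁅h, a⁆, (Subalgebra.mem_toSubmodule _).2 (hU a ha)⟩ =
      evalGen 𝔞 u ⟨((j - n : ℤ) : K) • a, (Subalgebra.mem_toSubmodule _).2 (Subalgebra.smul_mem _ ha _)⟩ := by
    rw [evalGen_apply, evalGen_apply]
    change ⁅h, a⁆ u = (((j - n : ℤ) : K) • a) u
    rw [Ring.lie_def, LinearMap.sub_apply, Module.End.mul_apply, Module.End.mul_apply, mem_degreeSpace_iff.1 hj,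
      mem_degreeSpace_iff.1 hu, map_smul, LinearMap.smul_apply, Int.cast_sub, sub_smul]
  have h2 := hinj h1
  exact congrArg Subtype.val h2

/-- … so `ev⁻¹` maps `M_j` into `𝔤𝔩(M)_{j+n}(ad h)` (`u ∈ M_{-n}`). [cite: LooijengaLunts1997, §6 (6.3) proof p. 23 L57–L62] -/
theorem evalGenEquiv_symm_mem_adDegree (hU : ∀ a ∈ Algebra.adjoin K (𝔞 : Set (Module.End K M)),
      ⁅h, a⁆ ∈ Algebra.adjoin K (𝔞 : Set (Module.End K M)))
    {n : ℤ} (hu : u ∈ degreeSpace h (-n)) {j : ℤ} {m : M} (hm : m ∈ degreeSpace h j) :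
    ((evalGenEquiv h𝔞 htop).symm m : Module.End K M) ∈ adDegree K h (((j + n : ℤ) : K)) := by
  rw [mem_adDegree_iff]
  have h1 := lie_eq_smul_of_apply_mem h𝔞 htop hU hu (evalGenEquiv_symm_mem h𝔞 htop m) (j := j)
    (by rw [evalGenEquiv_symm_apply_gen]; exact hm)
  rw [h1, sub_neg_eq_add]

end Evaluation

/-! ### §4 Frobenius modules: "`dim M_{-n} = 1`", "and so `M` is irreducible", "`dim M_n = 1`" -/

section Structure

variable {K : Type*} [Field K] [CharZero K] {M : Type*} [AddCommGroup M] [Module K M] [FiniteDimensional K M]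
  {h : Module.End K M} {𝔞 : Submodule K (Module.End K M)}

omit [CharZero K] [FiniteDimensional K M] in
/-- A one-dimensional `M_{-n}` is a line `K u`, `u ≠ 0`. [cite: LooijengaLunts1997, §6 (6.3) proof p. 23 L56–L57 ("Since dim M_{-n} = 1 … a generator u ∈ M_{-n}")] -/
theorem exists_eq_span_singleton_of_finrank_eq_one {S : Submodule K M} (h1 : Module.finrank K S = 1) :
    ∃ u ∈ S, u ≠ 0 ∧ S = K ∙ u := by
  obtain ⟨⟨u, hu⟩, hu0, hgen⟩ := finrank_eq_one_iff'.1 h1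
  refine ⟨u, hu, fun h0 ↦ hu0 (Subtype.ext h0), le_antisymm (fun w hw ↦ ?_) ?_⟩
  · obtain ⟨c, hc⟩ := hgen ⟨w, hw⟩
    exact Submodule.mem_span_singleton.2 ⟨c, congrArg Subtype.val hc⟩
  · rw [Submodule.span_singleton_le_iff_mem]
    exact hu

omit [CharZero K] [FiniteDimensional K M] in
/-- `ad h` preserves `U𝔞` for a Lefschetz module (`[h, e_a] = 2 e_a`). [cite: LooijengaLunts1997, §6 (6.3) proof p. 23 L57–L58 ("graded quotient R")] -/
theorem IsLefschetzModule.lie_h_mem_adjoin (A : IsLefschetzModule K h 𝔞) {a : Module.End K M}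
    (ha : a ∈ Algebra.adjoin K (𝔞 : Set (Module.End K M))) : ⁅h, a⁆ ∈ Algebra.adjoin K (𝔞 : Set (Module.End K M)) :=
  lie_mem_adjoin_of_forall_lie_mem h (fun b hb ↦ by
    rw [mem_adDegree_iff.1 (A.le_adDegree_two hb)]
    exact Subalgebra.smul_mem _ (Algebra.subset_adjoin hb) _) ha

omit [CharZero K] [FiniteDimensional K M] in
/-- `U𝔞` is commutative for a Lefschetz module. [cite: LooijengaLunts1997, §6 (6.3) proof p. 23 L58 ("the symmetric algebra U𝔞")] -/
theorem IsLefschetzModule.commute_adjoin (A : IsLefschetzModule K h 𝔞) : ∀ a ∈ 𝔞, ∀ b ∈ 𝔞, Commute a b :=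
  fun _ ha _ hb ↦ A.commute ha hb

/-- **"Since `dim M_{-n} = 1`, we also have `dim M_n = 1`"**: `dim M_n = dim M_{-n}` by the Lefschetz isomorphism
`e_a^n : M_{-n} ≅ M_n`. [cite: LooijengaLunts1997, §6 (6.3) proof p. 23 L56] -/
theorem IsLefschetzModule.finrank_degreeSpace_depth (A : IsLefschetzModule K h 𝔞) :
    Module.finrank K (degreeSpace h (depth h : ℤ)) = Module.finrank K (degreeSpace h (-(depth h : ℤ))) := by
  obtain ⟨e, -, L⟩ := A.exists_hasLefschetzProperty
  exact (L.powEquiv (n := (depth h : ℤ)) (by positivity)).finrank_eq.symm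

/-- **"(and so `M` is irreducible)"**, from (1) as read here: if `Prim(M) = M_{-n}` is a line, it has no `𝔤(𝔞, M)_0`-
stable subspaces besides `0` and itself, so `M` is irreducible by (1.13) (A1-103 `IsLefschetzModule.isIrreducible_iff`).
[cite: LooijengaLunts1997, §6 (6.1) (1) p. 23 L14–L15; §1 (1.13) p. 7 L49–L52] -/
theorem IsLefschetzModule.isIrreducible_of_primSubmodule_eq (A : IsLefschetzModule K h 𝔞) [Nontrivial M]
    (hP : primSubmodule h 𝔞 = degreeSpace h (-(depth h : ℤ)))
    (h1 : Module.finrank K (degreeSpace h (-(depth h : ℤ))) = 1) :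
    LieModule.IsIrreducible K (lefschetzLieAlgebra K h 𝔞) M := by
  refine A.isIrreducible_iff.2 fun W hWP _ ↦ ?_
  rw [hP] at hWP ⊢
  have h2 : Module.finrank K W ≤ 1 := h1 ▸ Submodule.finrank_mono hWP
  rcases Nat.le_one_iff_eq_zero_or_eq_one.1 h2 with h3 | h3
  · exact Or.inl (Submodule.finrank_eq_zero.1 h3)
  · exact Or.inr (Submodule.eq_of_le_of_finrank_eq hWP (h3.trans h1.symm))

/-- **For FROBENIUS modules the reading of (1) is immaterial: `dim M_{-n} = 1` together with (3) already forces
irreducibility.**  A `𝔤(𝔞, M)`-stable subspace `V` has a `𝔤(𝔞, M)`-stable complement `V'` (Weyl, for the semisimple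
`𝔤(𝔞, M)`); both are `h`-stable, so the line `M_{-n} = K u` decomposes compatibly and `u` has a non-zero component in
`V` or in `V'` — which then contains `u`, hence `U𝔞 u = M`. [cite: LooijengaLunts1997, §6 (6.1) p. 23 L14–L20] -/
theorem IsLefschetzModule.isIrreducible_of_envelopingSpan_eq_top (A : IsLefschetzModule K h 𝔞) [Nontrivial M]
    (h1 : Module.finrank K (degreeSpace h (-(depth h : ℤ))) = 1)
    (h3 : envelopingSpan 𝔞 (degreeSpace h (-(depth h : ℤ))) = ⊤) :
    LieModule.IsIrreducible K (lefschetzLieAlgebra K h 𝔞) M := by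
  classical
  haveI := A.isSemisimple
  obtain ⟨u, hu, hu0, hS⟩ := exists_eq_span_singleton_of_finrank_eq_one h1
  rw [isIrreducible_iff_forall_stable]
  intro V hV
  -- a stable subspace containing `u` is everything
  have key : ∀ W : Submodule K M, (∀ x ∈ lefschetzLieAlgebra K h 𝔞, ∀ v ∈ W, x v ∈ W) → u ∈ W → W = ⊤ := by
    intro W hW huW
    rw [eq_top_iff, ← h3]
    refine envelopingSpan_le (by rw [hS]; exact (Submodule.span_singleton_le_iff_mem u W).2 huW) fun a ha m hm ↦ ?_
    exact hW a (le_lefschetzLieAlgebra (K := K) (h := h) ha) m hm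
  -- Weyl: a stable complement
  let N : LieSubmodule K (lefschetzLieAlgebra K h 𝔞) M :=
    { V with
      lie_mem := fun {x m} hm ↦ by
        rw [LieSubalgebra.coe_bracket_of_module, Module.End.lie_apply]
        exact hV x.1 x.2 m hm }
  obtain ⟨N', hNN'⟩ := exists_isCompl_lieSubmodule_of_isSemisimple (k := K) N
  have hV' : ∀ x ∈ lefschetzLieAlgebra K h 𝔞, ∀ v ∈ (N' : Submodule K M), x v ∈ (N' : Submodule K M) := by
    intro x hx v hv
    have h4 := N'.lie_mem (x := ⟨x, hx⟩) hv
    rwa [LieSubalgebra.coe_bracket_of_module, Module.End.lie_apply] at h4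
  have hsup : (N : Submodule K M) ⊔ (N' : Submodule K M) = ⊤ := by
    have h4 := hNN'.sup_eq_top
    rw [← LieSubmodule.toSubmodule_inj, LieSubmodule.sup_toSubmodule, LieSubmodule.top_toSubmodule] at h4
    exact h4
  have hinf : (N : Submodule K M) ⊓ (N' : Submodule K M) = ⊥ := by
    have h4 := hNN'.inf_eq_bot
    rw [← LieSubmodule.toSubmodule_inj, LieSubmodule.inf_toSubmodule, LieSubmodule.bot_toSubmodule] at h4
    exact h4
  -- decompose `u = v + v'`
  obtain ⟨v, hv, v', hv', huv⟩ := Submodule.mem_sup.1 (show u ∈ (N : Submodule K M) ⊔ (N' : Submodule K M) by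
    rw [hsup]; exact Submodule.mem_top)
  have hhm := A.h_mem
  -- both components lie in `M_{-n}`: `h v + n v = -(h v' + n v') ∈ V ∩ V' = 0`
  have hn : (h v - ((-(depth h : ℤ) : ℤ) : K) • v) + (h v' - ((-(depth h : ℤ) : ℤ) : K) • v') = 0 := by
    have h4 := mem_degreeSpace_iff.1 hu
    rw [← huv, map_add, smul_add] at h4
    rw [← sub_eq_zero.2 h4]
    abel
  have hvV : h v - ((-(depth h : ℤ) : ℤ) : K) • v ∈ (N : Submodule K M) :=
    Submodule.sub_mem _ (hV h hhm v hv) (Submodule.smul_mem _ _ hv)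
  have hv'V : h v' - ((-(depth h : ℤ) : ℤ) : K) • v' ∈ (N' : Submodule K M) :=
    Submodule.sub_mem _ (hV' h hhm v' hv') (Submodule.smul_mem _ _ hv')
  have hvV' : h v - ((-(depth h : ℤ) : ℤ) : K) • v ∈ (N' : Submodule K M) := by
    have h4 : h v - ((-(depth h : ℤ) : ℤ) : K) • v = -(h v' - ((-(depth h : ℤ) : ℤ) : K) • v') :=
      eq_neg_of_add_eq_zero_left hn
    rw [h4]
    exact Submodule.neg_mem _ hv'V
  have hvdeg : v ∈ degreeSpace h (-(depth h : ℤ)) := by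
    rw [mem_degreeSpace_iff, ← sub_eq_zero]
    have h4 : h v - ((-(depth h : ℤ) : ℤ) : K) • v ∈ (N : Submodule K M) ⊓ (N' : Submodule K M) := ⟨hvV, hvV'⟩
    rwa [hinf, Submodule.mem_bot] at h4
  -- `v = c u`; either `c ≠ 0` (then `u ∈ V`) or `v = 0` (then `u = v' ∈ V'`)
  rw [hS] at hvdeg
  obtain ⟨c, rfl⟩ := Submodule.mem_span_singleton.1 hvdeg
  by_cases hc : c = 0
  · rw [hc, zero_smul, zero_add] at huv
    rw [huv] at hv'
    have h4 : (N' : Submodule K M) = ⊤ := key _ hV' hv'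
    left
    rw [← hinf, h4, inf_top_eq]
  · right
    refine key V hV ?_
    have h4 : c⁻¹ • c • u ∈ V := Submodule.smul_mem _ _ hv
    rwa [smul_smul, inv_mul_cancel₀ hc, one_smul] at h4

/-- … hence **`Prim(M) = M_{-n}`** for such modules ((1.13): for an irreducible `M`, `Prim(M)` is the lowest-degree
summand) — the clause of (1) as read above is automatic for Frobenius modules.
[cite: LooijengaLunts1997, §6 (6.1) p. 23 L14–L20; §1 (1.13) p. 7 L51–L52] -/
theorem IsLefschetzModule.primSubmodule_eq_of_envelopingSpan_eq_top (A : IsLefschetzModule K h 𝔞) [Nontrivial M]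
    (h1 : Module.finrank K (degreeSpace h (-(depth h : ℤ))) = 1)
    (h3 : envelopingSpan 𝔞 (degreeSpace h (-(depth h : ℤ))) = ⊤) :
    primSubmodule h 𝔞 = degreeSpace h (-(depth h : ℤ)) := by
  haveI := A.isIrreducible_of_envelopingSpan_eq_top h1 h3
  exact A.primSubmodule_eq_degreeSpace_of_isIrreducible

/-- **Constructor for `IsFrobeniusLefschetz` from `dim M_{-n} = 1`, (2) and (3)** (the clause `Prim(M) = M_{-n}` being
then automatic). [cite: LooijengaLunts1997, §6 (6.1) p. 23 L11–L20] -/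
theorem IsFrobeniusLefschetz.mk' (A : IsLefschetzModule K h 𝔞) [Nontrivial M]
    (h1 : Module.finrank K (degreeSpace h (-(depth h : ℤ))) = 1)
    (h2i : Function.Injective (actionMap K 𝔞 (degreeSpace h (-(depth h : ℤ)))))
    (h2s : LinearMap.range (actionMap K 𝔞 (degreeSpace h (-(depth h : ℤ)))) = degreeSpace h (-(depth h : ℤ) + 2))
    (h3 : envelopingSpan 𝔞 (degreeSpace h (-(depth h : ℤ))) = ⊤) : IsFrobeniusLefschetz K h 𝔞 where
  isLefschetzModule := A
  primSubmodule_eq := A.primSubmodule_eq_of_envelopingSpan_eq_top h1 h3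
  finrank_eq_one := h1
  injective_actionMap := h2i
  range_actionMap := h2s
  envelopingSpan_eq_top := h3

omit [CharZero K] [FiniteDimensional K M] in
/-- A Frobenius (indeed quasi-Frobenius) Lefschetz module is non-zero. [cite: LooijengaLunts1997, §6 (6.1) (1) p. 23 L14] -/
theorem IsQuasiFrobeniusLefschetz.nontrivial (Q : IsQuasiFrobeniusLefschetz K h 𝔞) : Nontrivial M := by
  obtain ⟨u, -, hu0, -⟩ := exists_eq_span_singleton_of_finrank_eq_one Q.finrank_eq_one
  exact nontrivial_of_ne u 0 hu0

/-- **(6.1) (1): "(and so `M` is irreducible)".** [cite: LooijengaLunts1997, §6 (6.1) (1) p. 23 L14–L15] -/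
theorem IsQuasiFrobeniusLefschetz.isIrreducible (Q : IsQuasiFrobeniusLefschetz K h 𝔞) :
    haveI := Q.nontrivial; LieModule.IsIrreducible K (lefschetzLieAlgebra K h 𝔞) M := by
  haveI := Q.nontrivial
  exact Q.isLefschetzModule.isIrreducible_of_primSubmodule_eq Q.primSubmodule_eq Q.finrank_eq_one

/-- In an irreducible Lefschetz module the non-zero degrees are `-n, -n+2, …, n` (`n = depth`): if `M_j ≠ 0` then
`j = -n + 2k` with `0 ≤ k ≤ n` (parity: A1-118 `IsLefschetzModule.degreeSpace_eq_bot_of_ne`; range: the depth).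
[cite: LooijengaLunts1997, §6 (6.3) proof p. 23 L61–L62 ("a ∈ R^{2k}, b ∈ R^{2n-2k}")] -/
theorem IsLefschetzModule.exists_eq_neg_depth_add_of_ne_bot (A : IsLefschetzModule K h 𝔞) [Nontrivial M]
    [LieModule.IsIrreducible K (lefschetzLieAlgebra K h 𝔞) M] {j : ℤ} (hj : degreeSpace h j ≠ ⊥) :
    ∃ k : ℕ, k ≤ depth h ∧ j = -(depth h : ℤ) + 2 * k := by
  obtain ⟨e, -, L⟩ := A.exists_hasLefschetzProperty
  have hpar : ∃ k : ℤ, j = -(depth h : ℤ) + 2 * k := by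
    by_contra hne
    push Not at hne
    exact hj (A.degreeSpace_eq_bot_of_ne hne)
  obtain ⟨k, hk⟩ := hpar
  -- range: `-n ≤ j ≤ n`
  have hle : j ≤ depth h := by
    by_contra hlt
    push Not at hlt
    have h1 : degreeSpace h ((j.toNat : ℕ) : ℤ) = ⊥ := L.degreeSpace_eq_bot_of_depth_lt (by omega)
    rw [Int.toNat_of_nonneg (by omega)] at h1
    exact hj h1
  have hge : -(depth h : ℤ) ≤ j := by
    by_contra hlt
    push Not at hlt
    have h1 : degreeSpace h (-(((-j).toNat : ℕ) : ℤ)) = ⊥ := L.degreeSpace_neg_eq_bot_of_depth_lt (by omega)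
    rw [Int.toNat_of_nonneg (by omega), neg_neg] at h1
    exact hj h1
  refine ⟨k.toNat, ?_, ?_⟩ <;> omega

end Structure

/-! ### §5 (6.3): the invariant `(-)^n`-symmetric form `⟨au, bu⟩ = (-1)^k ∫(abu)` -/

section Form

variable {K : Type*} [Field K] [CharZero K] {M : Type*} [AddCommGroup M] [Module K M] [FiniteDimensional K M]
  {h : Module.End K M} {𝔞 : Submodule K (Module.End K M)}

/-- **The sign `(-1)^k` on `M_{-n+2k}`**: the diagonal operator of `M = ⊕_j M_j(h)` acting on `M_j` by
`(-1)^{(j+n)/2}` (a combination of the component projectors `degreeComponent h j` of A1-149, themselves polynomials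
in `h`). [cite: LooijengaLunts1997, §6 (6.3) proof p. 23 L61–L62 ("⟨au, bu⟩ = (-1)^k ∫(abu) if a ∈ R^{2k}")] -/
def signOp (h : Module.End K M) (n : ℕ) : Module.End K M :=
  ∑ j ∈ (finite_setOf_degreeSpace_ne_bot h).toFinset, ((-1 : K) ^ ((j + n) / 2).toNat) • degreeComponent h j

/-- `signOp` acts on `M_j` by the scalar `(-1)^{((j+n)/2)}`. [cite: LooijengaLunts1997, §6 (6.3) proof p. 23 L61–L62] -/
theorem signOp_apply_of_mem (n : ℕ) {j : ℤ} {m : M} (hm : m ∈ degreeSpace h j) :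
    signOp h n m = ((-1 : K) ^ ((j + n) / 2).toNat) • m := by
  classical
  by_cases hj : degreeSpace h j = ⊥
  · rw [hj, Submodule.mem_bot] at hm
    rw [hm, map_zero, smul_zero]
  rw [signOp, LinearMap.sum_apply, Finset.sum_eq_single j]
  · rw [LinearMap.smul_apply, degreeComponent_apply_of_mem hm]
  · intro j' _ hj'
    rw [LinearMap.smul_apply, degreeComponent_apply_of_mem_ne hm (Ne.symm hj'), smul_zero]
  · intro hjS
    exact absurd ((finite_setOf_degreeSpace_ne_bot h).mem_toFinset.2 hj) hjS

/-- On `M_{-n+2k}` the sign is `(-1)^k`. [cite: LooijengaLunts1997, §6 (6.3) proof p. 23 L61–L62] -/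
theorem signOp_apply_of_mem' (n : ℕ) {k : ℕ} {m : M} (hm : m ∈ degreeSpace h (-(n : ℤ) + 2 * k)) :
    signOp h n m = ((-1 : K) ^ k) • m := by
  rw [signOp_apply_of_mem n hm]
  congr 2
  omega

/-- `signOp` preserves each `M_j`. [cite: LooijengaLunts1997, §6 (6.3) proof p. 23 L61–L62] -/
theorem signOp_apply_mem (n : ℕ) {j : ℤ} {m : M} (hm : m ∈ degreeSpace h j) : signOp h n m ∈ degreeSpace h j := by
  rw [signOp_apply_of_mem n hm]
  exact Submodule.smul_mem _ _ hm

/-- **The form of (6.3)**: `φ(m, m') = ∫((ev⁻¹(σ m)) m')` — for `m = a u` with `a ∈ R^{2k}` and `m' = b u` this is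
`(-1)^k ∫(a b u)` ("define a graded bilinear form `⟨ , ⟩ : M × M → ℂ` by `⟨au, bu⟩ = (-1)^k ∫(abu)` if `a ∈ R^{2k}`,
`b ∈ R^{2n-2k}`"); here `E : U𝔞 ≃ M` is the evaluation isomorphism at the generator `u`, `σ` the sign operator and
`∫ : M → K` a linear form (meant to vanish off `M_n`). [cite: LooijengaLunts1997, §6 (6.3) proof p. 23 L59–L62] -/
def frobeniusForm (E : ↥(Subalgebra.toSubmodule (Algebra.adjoin K (𝔞 : Set (Module.End K M)))) ≃ₗ[K] M)
    (σ : Module.End K M) (intg : Module.Dual K M) : BilinForm K M :=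
  (LinearMap.llcomp K M M K intg).comp
    (((Subalgebra.toSubmodule (Algebra.adjoin K (𝔞 : Set (Module.End K M)))).subtype.comp E.symm.toLinearMap).comp σ)

omit [CharZero K] [FiniteDimensional K M] in
/-- `φ(m, m') = ∫((ev⁻¹(σ m)) m')`. [cite: LooijengaLunts1997, §6 (6.3) proof p. 23 L59–L62] -/
@[simp] theorem frobeniusForm_apply (E : ↥(Subalgebra.toSubmodule (Algebra.adjoin K (𝔞 : Set (Module.End K M)))) ≃ₗ[K] M)
    (σ : Module.End K M) (intg : Module.Dual K M) (m m' : M) :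
    frobeniusForm E σ intg m m' = intg ((E.symm (σ m) : Module.End K M) m') := rfl

variable (A : IsLefschetzModule K h 𝔞) {u : M} (hu : u ∈ degreeSpace h (-(depth h : ℤ)))
  (htop : envelopingSpan 𝔞 (K ∙ u) = ⊤) {intg : Module.Dual K M}
  (hintg : ∀ j : ℤ, j ≠ depth h → ∀ m ∈ degreeSpace h j, intg m = 0)

/-- **"`⟨au, bu⟩ = (-1)^k ∫(abu)` if `a ∈ R^{2k}`"**: the value of the form on `m = a u ∈ M_{-n+2k}` and `m' = b u`.
[cite: LooijengaLunts1997, §6 (6.3) proof p. 23 L61–L62] -/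
theorem frobeniusForm_apply_apply_gen {a b : Module.End K M} (ha : a ∈ Algebra.adjoin K (𝔞 : Set (Module.End K M)))
    {k : ℕ} (hk : a u ∈ degreeSpace h (-(depth h : ℤ) + 2 * k)) (intg : Module.Dual K M) :
    frobeniusForm (evalGenEquiv A.commute_adjoin htop) (signOp h (depth h)) intg (a u) (b u) =
      (-1 : K) ^ k * intg ((a * b) u) := by
  rw [frobeniusForm_apply, signOp_apply_of_mem' (depth h) hk, LinearEquiv.map_smul, Submodule.coe_smul,
    evalGenEquiv_symm_apply_of_mem _ htop ha, LinearMap.smul_apply, Module.End.mul_apply, map_smul, smul_eq_mul]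

/-- **"annihilated by `𝔞`"**: `φ(a m, m') + φ(m, a m') = 0` for `a ∈ 𝔞` — on `m ∈ M_{-n+2k}` the sign of `a m` is
`-(-1)^k`, and `U𝔞` is commutative. [cite: LooijengaLunts1997, §6 (6.3) proof p. 23 L64–L67] -/
theorem isSkewAdjoint_frobeniusForm_of_mem [Nontrivial M] [LieModule.IsIrreducible K (lefschetzLieAlgebra K h 𝔞) M]
    (intg : Module.Dual K M) {a : Module.End K M} (ha : a ∈ 𝔞) :
    (frobeniusForm (evalGenEquiv A.commute_adjoin htop) (signOp h (depth h)) intg).IsSkewAdjoint a := by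
  set E := evalGenEquiv A.commute_adjoin htop with hE
  have haU : a ∈ Algebra.adjoin K (𝔞 : Set (Module.End K M)) := Algebra.subset_adjoin ha
  intro m m'
  rw [Pi.neg_apply, map_neg]
  -- reduce to homogeneous `m`
  have hm : m ∈ ⨆ j : ℤ, degreeSpace h j := by rw [A.isZGrading]; exact Submodule.mem_top
  refine Submodule.iSup_induction (fun j : ℤ ↦ degreeSpace h j)
    (motive := fun m ↦ frobeniusForm E (signOp h (depth h)) intg (a m) m' =
      -frobeniusForm E (signOp h (depth h)) intg m (a m')) hm (fun j m hmj ↦ ?_)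
    (by rw [map_zero, map_zero, LinearMap.zero_apply, LinearMap.zero_apply, neg_zero])
    (fun x y hx hy ↦ by rw [map_add, map_add, LinearMap.add_apply, map_add, LinearMap.add_apply, hx, hy, neg_add])
  by_cases hj : degreeSpace h j = ⊥
  · rw [hj, Submodule.mem_bot] at hmj
    rw [hmj, map_zero, map_zero, LinearMap.zero_apply, LinearMap.zero_apply, neg_zero]
  obtain ⟨k, -, rfl⟩ := A.exists_eq_neg_depth_add_of_ne_bot hj
  have ham : a m ∈ degreeSpace h (-(depth h : ℤ) + 2 * (k + 1 : ℕ)) := by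
    have h1 := A.mapsTo ha _ hmj
    rwa [show -(depth h : ℤ) + 2 * k + 2 = -(depth h : ℤ) + 2 * (k + 1 : ℕ) by push_cast; ring] at h1
  have hx := evalGenEquiv_symm_mem A.commute_adjoin htop m
  have hc : ((evalGenEquiv A.commute_adjoin htop).symm m : Module.End K M) (a m') =
      a (((evalGenEquiv A.commute_adjoin htop).symm m : Module.End K M) m') := by
    rw [← Module.End.mul_apply, (commute_of_mem_adjoin_of_mem_adjoin A.commute_adjoin hx haU).eq,
      Module.End.mul_apply]
  rw [frobeniusForm_apply, frobeniusForm_apply, signOp_apply_of_mem' (depth h) ham, signOp_apply_of_mem' (depth h) hmj]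
  simp only [Submodule.coe_smul, LinearMap.smul_apply, map_smul, smul_eq_mul, hE,
    evalGenEquiv_symm_apply_apply A.commute_adjoin htop haU, Module.End.mul_apply, hc, pow_succ]
  ring

include hu hintg in
/-- **"of degree zero"**: `φ(M_j, M_{j'}) = 0` unless `j + j' = 0` — `ev⁻¹(M_j) ⊆ R^{j+n}` raises degrees by `j + n`
and `∫` vanishes off `M_n`. [cite: LooijengaLunts1997, §6 (6.3) proof p. 23 L59 ("graded bilinear form"), L66 ("of degree zero")] -/
theorem frobeniusForm_apply_eq_zero_of_ne {j j' : ℤ} (hjj' : j + j' ≠ 0) {m : M} (hm : m ∈ degreeSpace h j) {m' : M}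
    (hm' : m' ∈ degreeSpace h j') :
    frobeniusForm (evalGenEquiv A.commute_adjoin htop) (signOp h (depth h)) intg m m' = 0 := by
  rw [frobeniusForm_apply]
  have h1 := evalGenEquiv_symm_mem_adDegree A.commute_adjoin htop (fun a ha ↦ A.lie_h_mem_adjoin ha) hu
    (signOp_apply_mem (depth h) hm)
  have h2 := mapsTo_of_mem_adDegree h1 j' hm'
  refine hintg (j' + (j + depth h)) (fun h3 ↦ hjj' ?_) _ h2
  omega

include hu hintg in
/-- … so `h` preserves `φ` infinitesimally. [cite: LooijengaLunts1997, §6 (6.3) proof p. 23 L66; §1 (1.3) p. 5 L3–L4] -/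
theorem isSkewAdjoint_frobeniusForm_h :
    (frobeniusForm (evalGenEquiv A.commute_adjoin htop) (signOp h (depth h)) intg).IsSkewAdjoint h :=
  isSkewAdjoint_of_forall_apply_eq_zero A.isZGrading fun _ _ hjj' _ hm _ hm' ↦
    frobeniusForm_apply_eq_zero_of_ne A hu htop hintg hjj' hm hm'

include hu hintg in
/-- **"We claim that it is `𝔤(𝔞, M)`-invariant … `⟨ , ⟩` is primitive for the `𝔰𝔩₂`-triple `(e_a, h, f_a)` and hence
annihilated by `f_a`"** — the tree's form of exactly this argument is A1-97
`isSkewAdjoint_of_mem_lefschetzLieAlgebra'`: a form killed by `h` and by `𝔞` is killed by all of `𝔤(𝔞, M)`.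
[cite: LooijengaLunts1997, §6 (6.3) proof p. 23 L64–L69] -/
theorem isSkewAdjoint_frobeniusForm_of_mem_lefschetzLieAlgebra [Nontrivial M]
    [LieModule.IsIrreducible K (lefschetzLieAlgebra K h 𝔞) M] {x : Module.End K M} (hx : x ∈ lefschetzLieAlgebra K h 𝔞) :
    (frobeniusForm (evalGenEquiv A.commute_adjoin htop) (signOp h (depth h)) intg).IsSkewAdjoint x :=
  isSkewAdjoint_of_mem_lefschetzLieAlgebra' (isSkewAdjoint_frobeniusForm_h A hu htop hintg)
    (fun _ ha ↦ isSkewAdjoint_frobeniusForm_of_mem A htop intg ha) hx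

include hu in
/-- `φ(u, m') = ∫ m'` (`ev⁻¹ u = 1`, sign `+1` in degree `-n`): so `φ ≠ 0` as soon as `∫ ≠ 0`.
[cite: LooijengaLunts1997, §6 (6.3) proof p. 23 L59 ("a nonzero linear form ∫")] -/
theorem frobeniusForm_gen_apply (intg : Module.Dual K M) (m' : M) :
    frobeniusForm (evalGenEquiv A.commute_adjoin htop) (signOp h (depth h)) intg u m' = intg m' := by
  have hu' : u ∈ degreeSpace h (-(depth h : ℤ) + 2 * (0 : ℕ)) := by
    rwa [Nat.cast_zero, mul_zero, add_zero]
  rw [frobeniusForm_apply, signOp_apply_of_mem' (depth h) hu', pow_zero, one_smul,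
    evalGenEquiv_symm_gen A.commute_adjoin htop, Module.End.one_apply]

include hu hintg in
/-- **"This form is symmetric or skew according to whether `n` is even or odd"**: `φ(m', m) = (-1)^n φ(m, m')` —
`U𝔞` is commutative and the signs of complementary degrees `-n+2k`, `n-2k` differ by `(-1)^n`.
[cite: LooijengaLunts1997, §6 (6.3) proof p. 23 L62–L63] -/
theorem frobeniusForm_comm [Nontrivial M] [LieModule.IsIrreducible K (lefschetzLieAlgebra K h 𝔞) M] (m m' : M) :
    frobeniusForm (evalGenEquiv A.commute_adjoin htop) (signOp h (depth h)) intg m' m =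
      (-1 : K) ^ depth h * frobeniusForm (evalGenEquiv A.commute_adjoin htop) (signOp h (depth h)) intg m m' := by
  set φ := frobeniusForm (evalGenEquiv A.commute_adjoin htop) (signOp h (depth h)) intg with hφ
  -- reduce to homogeneous `m`, `m'`
  have hm : m ∈ ⨆ j : ℤ, degreeSpace h j := by rw [A.isZGrading]; exact Submodule.mem_top
  have hm' : m' ∈ ⨆ j : ℤ, degreeSpace h j := by rw [A.isZGrading]; exact Submodule.mem_top
  refine Submodule.iSup_induction (fun j : ℤ ↦ degreeSpace h j) (motive := fun m ↦ φ m' m = (-1 : K) ^ depth h * φ m m')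
    hm (fun j m hmj ↦ ?_) (by rw [map_zero, map_zero, LinearMap.zero_apply, mul_zero])
    (fun x y hx hy ↦ by rw [map_add, map_add, LinearMap.add_apply, hx, hy, mul_add])
  refine Submodule.iSup_induction (fun j : ℤ ↦ degreeSpace h j) (motive := fun m' ↦ φ m' m = (-1 : K) ^ depth h * φ m m')
    hm' (fun j' m' hmj' ↦ ?_) (by rw [map_zero, map_zero, LinearMap.zero_apply, mul_zero])
    (fun x y hx hy ↦ by rw [map_add, map_add, LinearMap.add_apply, hx, hy, mul_add])
  by_cases hjj' : j + j' = 0; swap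
  · rw [hφ, frobeniusForm_apply_eq_zero_of_ne A hu htop hintg hjj' hmj hmj',
      frobeniusForm_apply_eq_zero_of_ne A hu htop hintg (by omega) hmj' hmj, mul_zero]
  by_cases hj : degreeSpace h j = ⊥
  · rw [hj, Submodule.mem_bot] at hmj
    simp only [hmj, map_zero, LinearMap.zero_apply, mul_zero]
  obtain ⟨k, hk, rfl⟩ := A.exists_eq_neg_depth_add_of_ne_bot hj
  have hj' : j' = -(depth h : ℤ) + 2 * (depth h - k : ℕ) := by push_cast [hk]; omega
  rw [hj'] at hmj'
  -- write `m = a u`, `m' = b u`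
  obtain ⟨a, rfl⟩ := (evalGenEquiv A.commute_adjoin htop).surjective m
  obtain ⟨b, rfl⟩ := (evalGenEquiv A.commute_adjoin htop).surjective m'
  have ha := (Subalgebra.mem_toSubmodule _).1 a.2
  have hb := (Subalgebra.mem_toSubmodule _).1 b.2
  simp only [evalGenEquiv_apply] at hmj hmj' ⊢
  rw [hφ, frobeniusForm_apply_apply_gen A htop hb hmj', frobeniusForm_apply_apply_gen A htop ha hmj,
    (commute_of_mem_adjoin_of_mem_adjoin A.commute_adjoin ha hb).eq, ← mul_assoc]
  congr 1
  have h1 : (-1 : K) ^ (depth h - k) * (-1) ^ k = (-1) ^ depth h := by rw [← pow_add, Nat.sub_add_cancel hk]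
  have h2 : (-1 : K) ^ k * (-1) ^ k = 1 := by rw [← pow_add, ← two_mul, pow_mul, neg_one_sq, one_pow]
  calc (-1 : K) ^ (depth h - k) = (-1 : K) ^ (depth h - k) * ((-1) ^ k * (-1) ^ k) := by rw [h2, mul_one]
    _ = (-1) ^ depth h * (-1) ^ k := by rw [← mul_assoc, h1]

/-- **"Pick a nonzero linear form `∫ : R_{2n} → ℂ`"**: on `M = ⊕_j M_j` there is a linear form vanishing on the `M_j`,
`j ≠ n`, and not on `M_n` (when `M_n ≠ 0`). [cite: LooijengaLunts1997, §6 (6.3) proof p. 23 L59] -/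
theorem exists_dual_eq_zero_off_degree {n : ℤ} (hn : degreeSpace h n ≠ ⊥) :
    ∃ intg : Module.Dual K M, (∀ j : ℤ, j ≠ n → ∀ m ∈ degreeSpace h j, intg m = 0) ∧ ∃ w ∈ degreeSpace h n, intg w ≠ 0 := by
  obtain ⟨w, hw, hw0⟩ := (Submodule.ne_bot_iff _).1 hn
  have hind : iSupIndep fun m : ℤ ↦ degreeSpace h m :=
    (Module.End.eigenspaces_iSupIndep h).comp (f := fun m : ℤ ↦ (m : K)) Int.cast_injective
  have hdisj : Disjoint (degreeSpace h n) (⨆ (j : ℤ) (_ : j ≠ n), degreeSpace h j) :=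
    hind.disjoint_biSup (y := {j | j ≠ n}) (fun h1 ↦ h1 rfl)
  have hwn : w ∉ ⨆ (j : ℤ) (_ : j ≠ n), degreeSpace h j := fun h1 ↦
    hw0 ((Submodule.disjoint_def.1 hdisj) w hw h1)
  obtain ⟨intg, h1, h2⟩ := Submodule.exists_dual_map_eq_bot_of_notMem hwn inferInstance
  refine ⟨intg, fun j hj m hm ↦ ?_, w, hw, h1⟩
  have h3 : intg m ∈ Submodule.map intg (⨆ (j : ℤ) (_ : j ≠ n), degreeSpace h j) :=
    ⟨m, Submodule.mem_iSup_of_mem j (Submodule.mem_iSup_of_mem hj hm), rfl⟩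
  rw [h2, Submodule.mem_bot] at h3
  exact h3

/-- **LOOIJENGA–LUNTS (6.3) PROPOSITION. "Let `(𝔞, M)` be a Frobenius–Lefschetz module of depth `n`. Then there
exists a nondegenerate `𝔤(𝔞, M)`-invariant `(-)^n`-symmetric bilinear form on `M`."**  Rendered: a bilinear form
`φ` on `M` which is non-degenerate (Mathlib `LinearMap.BilinForm.Nondegenerate`), preserved infinitesimally by every
`x ∈ 𝔤(𝔞, M)` (`φ(x m, m') + φ(m, x m') = 0`, Mathlib `IsSkewAdjoint`), graded (`φ(M_j, M_{j'}) = 0` unless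
`j + j' = 0`, the (1.3) sense of an invariant form on a Lefschetz module) and `(-)^n`-symmetric:
`φ(m', m) = (-1)^n φ(m, m')`.  Proof as printed (§5 of this file): `⟨au, bu⟩ = (-1)^k ∫(abu)`; non-degenerate as a
non-zero invariant form on the irreducible `M` (A1-120 `IsLefschetzModule.nondegenerate_of_isIrreducible`).
[cite: LooijengaLunts1997, §6 (6.3) Proposition and proof, p. 23 L53–L70] -/
theorem IsFrobeniusLefschetz.exists_bilinForm (F : IsFrobeniusLefschetz K h 𝔞) :
    ∃ φ : BilinForm K M, φ.Nondegenerate ∧ (∀ x ∈ lefschetzLieAlgebra K h 𝔞, φ.IsSkewAdjoint x) ∧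
      (∀ j j' : ℤ, j + j' ≠ 0 → ∀ m ∈ degreeSpace h j, ∀ m' ∈ degreeSpace h j', φ m m' = 0) ∧
      ∀ m m' : M, φ m' m = (-1 : K) ^ depth h * φ m m' := by
  have A := F.isLefschetzModule
  haveI := F.nontrivial
  haveI := F.isIrreducible
  -- "Since `dim M_{-n} = 1` … a generator `u ∈ M_{-n}`"
  obtain ⟨u, hu, hu0, hS⟩ := exists_eq_span_singleton_of_finrank_eq_one F.finrank_eq_one
  have htop : envelopingSpan 𝔞 (K ∙ u) = ⊤ := by rw [← hS]; exact F.envelopingSpan_eq_top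
  -- "we also have `dim M_n = 1`. Pick a nonzero linear form `∫`"
  have hn : degreeSpace h (depth h : ℤ) ≠ ⊥ := by
    intro h0
    have h1 := A.finrank_degreeSpace_depth
    rw [h0, finrank_bot, F.finrank_eq_one] at h1
    exact zero_ne_one h1
  obtain ⟨intg, hintg, w, hw, hw0⟩ := exists_dual_eq_zero_off_degree hn
  set φ := frobeniusForm (evalGenEquiv A.commute_adjoin htop) (signOp h (depth h)) intg with hφ
  have hskew : ∀ x ∈ lefschetzLieAlgebra K h 𝔞, φ.IsSkewAdjoint x :=
    fun x hx ↦ isSkewAdjoint_frobeniusForm_of_mem_lefschetzLieAlgebra A hu htop hintg hx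
  have hne : φ ≠ 0 := by
    intro h0
    apply hw0
    rw [← frobeniusForm_gen_apply A hu htop intg w, ← hφ, h0, LinearMap.zero_apply, LinearMap.zero_apply]
  refine ⟨φ, ?_, hskew, fun j j' hjj' m hm m' hm' ↦ frobeniusForm_apply_eq_zero_of_ne A hu htop hintg hjj' hm hm',
    fun m m' ↦ frobeniusForm_comm A hu htop hintg m m'⟩
  -- "Since `M` is irreducible, `⟨ , ⟩` must be nondegenerate."
  exact A.nondegenerate_of_isIrreducible hne (isSkewAdjoint_frobeniusForm_h A hu htop hintg)
    fun a ha ↦ isSkewAdjoint_frobeniusForm_of_mem A htop intg ha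

end Form

/-! ### §6 Model (non-vacuity): `H^•(ℙ¹) = K[ε]/(ε²)`, `deg ε = 2`, is a Frobenius–Lefschetz module of depth `1` -/

section Model

open TrivSqZeroExt DualNumber LefschetzDualNumber

variable (K : Type*) [Field K]

namespace LefschetzDualNumber

-- the graded-algebra structure of `K[ε]/(ε²)` of A1-121 (a `def` there), enabled file-locally as in that file
attribute [local instance] gradedAlgebra

/-- `K[ε]/(ε²)` is finite-dimensional (it is `K × K`). [folklore] -/
private theorem finiteDimensional' : FiniteDimensional K (DualNumber K) :=
  inferInstanceAs (FiniteDimensional K (K × K))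

/-- `K[ε]/(ε²) ≠ 0`. [folklore] -/
private theorem nontrivial' : Nontrivial (DualNumber K) := inferInstanceAs (Nontrivial (K × K))

variable [CharZero K]

/-- `A[1]_{-1} = A_0 = K · 1`. [cite: LooijengaLunts1997, §1 (1.4) p. 5 L17–L20; §6 (6.1) p. 23 L28–L29 ("if A is Lefschetz algebra of depth n, then A[n] is a Frobenius–Lefschetz module of A_2 if and only if A is generated by A_2")] -/
theorem degreeSpace_neg_one_eq_span : degreeSpace (shiftedDegree K (grading K) 1) (-1) = K ∙ (1 : DualNumber K) := by
  rw [degreeSpace_neg_one, grading_zero]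
  refine le_antisymm ?_ ((Submodule.span_singleton_le_iff_mem _ _).2 ⟨1, by rw [Algebra.linearMap_apply, map_one]⟩)
  rintro _ ⟨c, rfl⟩
  rw [Algebra.linearMap_apply, Algebra.algebraMap_eq_smul_one]
  exact Submodule.smul_mem _ c (Submodule.mem_span_singleton_self _)

/-- (1b) for the model: `dim A[1]_{-1} = 1`. [cite: LooijengaLunts1997, §6 (6.1) (1) p. 23 L14, L28–L29] -/
theorem finrank_degreeSpace_neg_one : Module.finrank K (degreeSpace (shiftedDegree K (grading K) 1) (-1)) = 1 := by
  rw [degreeSpace_neg_one_eq_span, finrank_span_singleton one_ne_zero]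

/-- (3) for the model: `U𝔞 · A_0 = A` (`A = K[ε]/(ε²)` is generated by `A_2 = K ε`).
[cite: LooijengaLunts1997, §6 (6.1) (3) p. 23 L20, L28–L29] -/
theorem envelopingSpan_eq_top :
    envelopingSpan (mulLeftDegTwo K (grading K)) (degreeSpace (shiftedDegree K (grading K) 1) (-1)) = ⊤ := by
  rw [eq_top_iff]
  intro x _
  have h1 : (1 : DualNumber K) ∈ envelopingSpan (mulLeftDegTwo K (grading K))
      (degreeSpace (shiftedDegree K (grading K) 1) (-1)) :=
    le_envelopingSpan (by rw [degreeSpace_neg_one_eq_span]; exact Submodule.mem_span_singleton_self _)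
  have hε : (ε : DualNumber K) ∈ envelopingSpan (mulLeftDegTwo K (grading K))
      (degreeSpace (shiftedDegree K (grading K) 1) (-1)) := by
    have h2 := apply_mem_envelopingSpan (Algebra.subset_adjoin (mul_eps_mem K)) h1
    rwa [LinearMap.mul_apply', mul_one] at h2
  have hx : x = x.fst • (1 : DualNumber K) + x.snd • ε := by
    conv_lhs => rw [← inl_fst_add_inr_snd_eq x]
    rw [inr_eq_smul_eps]
    congr 1
    exact TrivSqZeroExt.ext (by rw [fst_inl, fst_smul, fst_one, smul_eq_mul, mul_one])
      (by rw [snd_inl, snd_smul, snd_one, smul_zero])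
  rw [hx]
  exact Submodule.add_mem _ (Submodule.smul_mem _ _ h1) (Submodule.smul_mem _ _ hε)

/-- (2b) for the model: the image of `𝔞 ⊗ A[1]_{-1} → A[1]` is `A[1]_1 = K ε`. [cite: LooijengaLunts1997, §6 (6.1) (2) p. 23 L17–L18, L28–L29] -/
theorem range_actionMap_eq :
    LinearMap.range (actionMap K (mulLeftDegTwo K (grading K)) (degreeSpace (shiftedDegree K (grading K) 1) (-1))) =
      degreeSpace (shiftedDegree K (grading K) 1) (-1 + 2) := by
  haveI := finiteDimensional' K
  refine le_antisymm (range_actionMap_le (fun a ha k ↦ (isLefschetzModule K).mapsTo ha k) (-1)) ?_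
  rw [show (-1 : ℤ) + 2 = 1 by norm_num, degreeSpace_one, grading_two_eq_span, Submodule.span_singleton_le_iff_mem]
  refine ⟨⟨LinearMap.mul K (DualNumber K) ε, mul_eps_mem K⟩ ⊗ₜ
    ⟨1, by rw [degreeSpace_neg_one_eq_span]; exact Submodule.mem_span_singleton_self _⟩, ?_⟩
  rw [actionMap_tmul, LinearMap.mul_apply', mul_one]

/-- (2a) for the model: `𝔞 ⊗ A[1]_{-1} → A[1]` is injective (`𝔞 ⊗ A_0 = K (L_ε ⊗ 1)` and `L_ε 1 = ε ≠ 0`).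
[cite: LooijengaLunts1997, §6 (6.1) (2) p. 23 L17–L18, L28–L29] -/
theorem injective_actionMap :
    Function.Injective (actionMap K (mulLeftDegTwo K (grading K)) (degreeSpace (shiftedDegree K (grading K) 1) (-1))) := by
  set t₀ : ↥(mulLeftDegTwo K (grading K)) ⊗[K] ↥(degreeSpace (shiftedDegree K (grading K) 1) (-1)) :=
    ⟨LinearMap.mul K (DualNumber K) ε, mul_eps_mem K⟩ ⊗ₜ
      ⟨1, by rw [degreeSpace_neg_one_eq_span]; exact Submodule.mem_span_singleton_self _⟩ with ht₀
  -- every tensor is a multiple of `L_ε ⊗ 1`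
  have key : ∀ t : ↥(mulLeftDegTwo K (grading K)) ⊗[K] ↥(degreeSpace (shiftedDegree K (grading K) 1) (-1)),
      ∃ c : K, t = c • t₀ := by
    intro t
    induction t using TensorProduct.induction_on with
    | zero => exact ⟨0, by rw [zero_smul]⟩
    | tmul a v =>
      have ha : (a : Module.End K (DualNumber K)) ∈ K ∙ LinearMap.mul K (DualNumber K) ε := by
        rw [← mulLeftDegTwo_eq_span]; exact a.2
      have hv : (v : DualNumber K) ∈ K ∙ (1 : DualNumber K) := by
        rw [← degreeSpace_neg_one_eq_span]; exact v.2
      obtain ⟨c₁, hc₁⟩ := Submodule.mem_span_singleton.1 ha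
      obtain ⟨c₂, hc₂⟩ := Submodule.mem_span_singleton.1 hv
      refine ⟨c₁ * c₂, ?_⟩
      have ha' : a = c₁ • ⟨LinearMap.mul K (DualNumber K) ε, mul_eps_mem K⟩ := Subtype.ext hc₁.symm
      have hv' : v = c₂ • ⟨1, by rw [degreeSpace_neg_one_eq_span]; exact Submodule.mem_span_singleton_self _⟩ :=
        Subtype.ext hc₂.symm
      rw [ha', hv', TensorProduct.smul_tmul, TensorProduct.tmul_smul, TensorProduct.tmul_smul, smul_smul]
    | add x y hx hy =>
      obtain ⟨c, rfl⟩ := hx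
      obtain ⟨d, rfl⟩ := hy
      exact ⟨c + d, by rw [add_smul]⟩
  intro t t' htt'
  obtain ⟨c, rfl⟩ := key t
  obtain ⟨c', rfl⟩ := key t'
  have h0 : actionMap K _ _ t₀ = (ε : DualNumber K) := by rw [ht₀, actionMap_tmul, LinearMap.mul_apply', mul_one]
  rw [map_smul, map_smul, h0] at htt'
  have hε : (ε : DualNumber K) ≠ 0 := fun h ↦ one_ne_zero ((TrivSqZeroExt.ext_iff.1 h).2.trans snd_zero)
  rw [smul_left_injective K hε htt']

/-- **`H^•(ℙ¹; K)[1] = (K[ε]/(ε²))[1]` over `A_2 = K ε` IS A FROBENIUS–LEFSCHETZ MODULE of depth `1`** — a non-vacuity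
witness for (6.1), and the simplest instance of the remark "if `A` is Lefschetz algebra of depth `n`, then `A[n]` is a
Frobenius–Lefschetz module of `A_2` if and only if `A` is generated by `A_2`". [cite: LooijengaLunts1997, §6 (6.1) p. 23 L11–L20, L28–L29] -/
theorem isFrobeniusLefschetz : IsFrobeniusLefschetz K (shiftedDegree K (grading K) 1) (mulLeftDegTwo K (grading K)) := by
  haveI := finiteDimensional' K
  haveI := nontrivial' K
  have hd : -(depth (shiftedDegree K (grading K) 1) : ℤ) = -1 := by rw [depth_eq_one, Nat.cast_one]
  refine IsFrobeniusLefschetz.mk' (isLefschetzModule K) ?_ ?_ ?_ ?_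
  · rw [hd]; exact finrank_degreeSpace_neg_one K
  · rw [hd]; exact injective_actionMap K
  · rw [hd]; exact range_actionMap_eq K
  · rw [hd]; exact envelopingSpan_eq_top K

/-- … so, by (6.3), `H^•(ℙ¹; K)[1]` carries a non-degenerate `𝔤`-invariant SKEW (`(-1)^1`-symmetric) form — the
symplectic form of the `2`-dimensional `𝔰𝔩₂`-module. [cite: LooijengaLunts1997, §6 (6.3) p. 23 L53–L55] -/
theorem exists_bilinForm_skew : ∃ φ : BilinForm K (DualNumber K), φ.Nondegenerate ∧
    (∀ x ∈ lefschetzLieAlgebra K (shiftedDegree K (grading K) 1) (mulLeftDegTwo K (grading K)), φ.IsSkewAdjoint x) ∧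
      ∀ m m' : DualNumber K, φ m' m = -φ m m' := by
  haveI := finiteDimensional' K
  obtain ⟨φ, h1, h2, -, h4⟩ := (isFrobeniusLefschetz K).exists_bilinForm
  refine ⟨φ, h1, h2, fun m m' ↦ ?_⟩
  rw [h4, depth_eq_one, pow_one, neg_one_mul]

end LefschetzDualNumber

end Model

end Literature.Algebra.Lie
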